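/-
HONEST FRAMING: certified error envelopes and provably optimal rounding/accumulation schemes for
low-precision formats under stated cost models; every table by two implementations; no hardware
or vendor claims.
-/
import Summits.Ventures.CertifiedArithmetic.LowPrec.OptDemotionWitness

/-!
# The labelled chain law (Theorem T9): recursive summation through ANY sequence of precisions

Cost model CM-B/chain-labels (OPTIMA.md §B, Theorem T9).  A running sum `S` is updated `n` times,
`S_i = fl_i (S_{i-1} + x_i)`, where step `i` rounds to nearest (any tie rule, gradual underflow)
into ITS OWN binary format `F(π_i, emin)` — the precisions `π_1, …, π_n ≥ 1` are arbitrary and in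
any order (promotions, demotions, mixed accumulators); a pure format conversion of the running sum
is a step with `x_i = 0`.  The start value `S_0 = acc ≥ 0` and the summands `x_i ≥ 0` are any
numbers of the grid `2^emin ℤ` (so: nonnegative floats of any formats `F(r, emin)`).

*  UPPER BOUND (`exact_le_lchain`): `acc + Σ x_i ≤ (1 + Σ_i u_{π_i}) · S_n` (`u_π = 2^-π`), for
   EVERY precision sequence, with no condition on `n` and no higher-order term: the relative
   under-estimation never exceeds `1 - 1/(1 + Σ_i u_{π_i})`.  Only the MULTISET of step precisions
   enters — the order of the formats along the chain is irrelevant.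
*  ATTAINMENT (`lchain_attained_add`, `R4_LabelledChainLaw_holds` (b)): for every precision
   sequence the bound is attained — `acc = 2^e`, `x_i = u_{π_i} 2^e` and nearest maps with
   ties-to-even at the binade points (IEEE roundTiesToEven has them) keep `S_i = 2^e` for ever.
*  DOUBLE ROUNDING (file `OptChainLabelsDR.lean`: `exact_le_doubleRounding`, `doubleRounding_attained`): the "every addition
   double rounded" recursive summation (round to the wide `F(q)`, convert at once to the narrow
   `F(p)`; the model of [MMM13] Martin-Dorel–Melquiond–Muller, BIT 53 (2013) §6) is the labelled
   chain `q,p,q,p,…`: `s ≤ (1 + (n-1)(u_q + u_p)) · ŝ` exactly — linear in `n`, no cross term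
   `u_p u_q` — and attained for `q ≥ p + 1` by nearest maps with the tie resolutions
   `TiesDownAtShift`/`TiesEvenAtPow` (IEEE ties-to-even has both when `q ≥ p + 2`).
*  T8(a) (`exact_le_demotion_sequential`, accumulate wide then demote once) is the special case
   `q,…,q,p` (`demotion_of_lchain`, file `OptChainLabelsDR.lean`, which also states and proves the
   R4 form `R4_LabelledChainLaw`); T4(d) is the constant sequence.

Ingredients: powers of two `2^k`, `k ≥ emin`, are floats of EVERY format, so a lower bound
`2^k ≤ S_{i-1}` survives every later step whatever its precision (`zpow_le_lchainEval`); hence every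
rounding of the chain happens in a binade `≤ ufp(S_n)` and loses at most `u_{π_i} · ufp(S_n)`
(half-ulp bound `abs_sub_fl_le_half_ulp`), nothing below the underflow threshold (grid numbers
below `2^(emin+π)` are floats of `F(π, emin)`).
-/

namespace Summit.Ventures.CertifiedArithmetic.LowPrec.Opt

open Literature.ComputerArithmetic.JeannerodRump2018

/-! ## Labelled chains -/

/-- One step of a LABELLED CHAIN: the running sum `S` becomes `fl (S + x)`, `fl` rounding to nearest
into the binary format `F(prec, emin)`.  A pure conversion of the running sum is a step with `x = 0`. -/
structure LStep where
  /-- precision of the format this step rounds into -/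
  prec : ℕ
  /-- the rounding map of this step -/
  fl : ℚ → ℚ
  /-- the summand added at this step (`0` for a pure conversion) -/
  x : ℚ

/-- Evaluate a labelled chain from the start value `acc`: `S₀ = acc`, `S_i = fl_i (S_{i-1} + x_i)`. -/
def lchainEval (acc : ℚ) : List LStep → ℚ
  | [] => acc
  | s :: ss => lchainEval (s.fl (acc + s.x)) ss

/-- `lchainEval` on the empty chain. -/
@[simp] theorem lchainEval_nil (acc : ℚ) : lchainEval acc [] = acc := rfl

/-- `lchainEval` unfolds one step. -/
@[simp] theorem lchainEval_cons (acc : ℚ) (s : LStep) (ss : List LStep) :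
    lchainEval acc (s :: ss) = lchainEval (s.fl (acc + s.x)) ss := rfl

/-- Chains compose. -/
theorem lchainEval_append : ∀ (ss ts : List LStep) (acc : ℚ),
    lchainEval acc (ss ++ ts) = lchainEval (lchainEval acc ss) ts
  | [], _, _ => rfl
  | s :: ss, ts, acc => by
      rw [List.cons_append, lchainEval_cons, lchainEval_cons]
      exact lchainEval_append ss ts _

/-- Sum of the summands of a chain. -/
def xsum (ss : List LStep) : ℚ := (ss.map LStep.x).sum

/-- Sum of the unit roundoffs `u_{π_i} = 2^{-π_i}` of the steps of a chain. -/
def usum (ss : List LStep) : ℚ := (ss.map fun s => unitRoundoff s.prec).sum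

/-- `xsum [] = 0`. -/
@[simp] theorem xsum_nil : xsum [] = 0 := rfl
/-- `usum [] = 0`. -/
@[simp] theorem usum_nil : usum [] = 0 := rfl
/-- `xsum` of a cons. -/
@[simp] theorem xsum_cons (s : LStep) (ss : List LStep) : xsum (s :: ss) = s.x + xsum ss := by
  simp [xsum]
/-- `usum` of a cons. -/
@[simp] theorem usum_cons (s : LStep) (ss : List LStep) :
    usum (s :: ss) = unitRoundoff s.prec + usum ss := by
  simp [usum]
/-- `xsum` is additive under concatenation. -/
@[simp] theorem xsum_append (ss ts : List LStep) : xsum (ss ++ ts) = xsum ss + xsum ts := by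
  simp [xsum]
/-- `usum` is additive under concatenation. -/
@[simp] theorem usum_append (ss ts : List LStep) : usum (ss ++ ts) = usum ss + usum ts := by
  simp [usum]

/-- `usum ≥ 0`. -/
theorem usum_nonneg : ∀ ss : List LStep, 0 ≤ usum ss
  | [] => le_rfl
  | s :: ss => by rw [usum_cons]; exact add_nonneg (unitRoundoff_nonneg _) (usum_nonneg ss)

/-! ## The grid `2^emin ℤ` -/

/-- `t` lies on the grid `2^emin ℤ`; every float of every format `F(r, emin)` does. -/
def IsGrid (emin : ℤ) (t : ℚ) : Prop := ∃ N : ℤ, t = (N : ℚ) * (2 : ℚ) ^ emin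

/-- Floats are grid numbers. -/
theorem isGrid_of_isFloat {r : ℕ} {emin : ℤ} {x : ℚ} (h : IsFloat r emin x) : IsGrid emin x :=
  h.exists_int_mul_zpow_emin

/-- `0` is a grid number. -/
theorem isGrid_zero (emin : ℤ) : IsGrid emin 0 := ⟨0, by simp⟩

/-- The grid is closed under addition. -/
theorem IsGrid.add {emin : ℤ} {a b : ℚ} (ha : IsGrid emin a) (hb : IsGrid emin b) :
    IsGrid emin (a + b) := by
  obtain ⟨A, rfl⟩ := ha
  obtain ⟨B, rfl⟩ := hb
  exact ⟨A + B, by push_cast; ring⟩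

/-- A nonnegative grid number below `2^(emin + p)` is a float of `F(p, emin)` (it is `N·2^emin`
with `0 ≤ N < 2^p`): additions whose exact result is that small are exact in `F(p, emin)`. -/
theorem IsGrid.isFloat_of_lt {p : ℕ} {emin : ℤ} {t : ℚ} (ht : IsGrid emin t) (ht0 : 0 ≤ t)
    (hsmall : t < (2 : ℚ) ^ (emin + p)) : IsFloat p emin t := by
  obtain ⟨N, hN⟩ := ht
  have h2 : (0 : ℚ) < (2 : ℚ) ^ emin := zpow_pos (by norm_num) _
  rw [hN]
  refine isFloat_of_int_mul N emin ?_ le_rfl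
  rw [hN, zpow_add₀ (by norm_num : (2 : ℚ) ≠ 0), zpow_natCast, mul_comm] at hsmall
  have hN0 : (0 : ℚ) ≤ N := by
    by_contra h
    have : (N : ℚ) * (2 : ℚ) ^ emin < 0 := mul_neg_of_neg_of_pos (not_le.mp h) h2
    linarith
  have hlt : (N : ℚ) < 2 ^ p := lt_of_mul_lt_mul_left hsmall h2.le
  have hlt' : N < (2 : ℤ) ^ p := by exact_mod_cast hlt
  have hN0' : 0 ≤ N := by exact_mod_cast hN0
  rw [abs_of_nonneg hN0']; exact hlt'

/-- A positive grid number is at least `2^emin`. -/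
theorem IsGrid.zpow_le_of_pos {emin : ℤ} {t : ℚ} (ht : IsGrid emin t) (hpos : 0 < t) :
    (2 : ℚ) ^ emin ≤ t := by
  obtain ⟨N, rfl⟩ := ht
  have h2 : (0 : ℚ) < (2 : ℚ) ^ emin := zpow_pos (by norm_num) _
  have hN : (0 : ℚ) < (N : ℚ) := by
    by_contra h
    have : (N : ℚ) * (2 : ℚ) ^ emin ≤ 0 := mul_nonpos_of_nonpos_of_nonneg (not_lt.mp h) h2.le
    linarith
  have hN' : (0 : ℤ) < N := by exact_mod_cast hN
  have hN1 : (1 : ℚ) ≤ (N : ℚ) := by exact_mod_cast hN'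
  calc (2 : ℚ) ^ emin = 1 * (2 : ℚ) ^ emin := by ring
    _ ≤ (N : ℚ) * (2 : ℚ) ^ emin := mul_le_mul_of_nonneg_right hN1 h2.le

/-! ## Admissible steps and the structural lemmas -/

/-- An ADMISSIBLE step: precision `≥ 1`, a nearest map into `F(prec, emin)`, a nonnegative summand
on the grid `2^emin ℤ`. -/
def LStep.OK (emin : ℤ) (s : LStep) : Prop :=
  1 ≤ s.prec ∧ IsRoundNearest s.prec emin s.fl ∧ 0 ≤ s.x ∧ IsGrid emin s.x

/-- The computed value of an admissible chain from a nonnegative start is nonnegative (`0` is a float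
of every format). -/
theorem lchainEval_nonneg {emin : ℤ} :
    ∀ (ss : List LStep) (acc : ℚ), 0 ≤ acc → (∀ s ∈ ss, s.OK emin) → 0 ≤ lchainEval acc ss
  | [], acc, h, _ => by simpa using h
  | s :: ss, acc, hacc, hss => by
      obtain ⟨-, hfl, hx0, -⟩ := hss s (by simp)
      have hrest : ∀ t ∈ ss, t.OK emin := fun t ht => hss t (by simp [ht])
      rw [lchainEval_cons]
      exact lchainEval_nonneg ss _ (le_fl_of_isFloat_le hfl (isFloat_zero _ _) (by linarith)) hrest

/-- POWERS OF TWO PROPAGATE: `2^k`, `k ≥ emin`, is a float of every format, so a lower bound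
`2^k ≤ S` on the running sum survives every later step of the chain, whatever its precision. -/
theorem zpow_le_lchainEval {emin : ℤ} :
    ∀ (ss : List LStep) (acc : ℚ), (∀ s ∈ ss, s.OK emin) → ∀ {k : ℤ}, emin ≤ k →
      (2 : ℚ) ^ k ≤ acc → (2 : ℚ) ^ k ≤ lchainEval acc ss
  | [], acc, _, k, _, h => by simpa using h
  | s :: ss, acc, hss, k, hk, hacc => by
      obtain ⟨hp1, hfl, hx0, -⟩ := hss s (by simp)
      have hrest : ∀ t ∈ ss, t.OK emin := fun t ht => hss t (by simp [ht])
      rw [lchainEval_cons]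
      exact zpow_le_lchainEval ss _ hrest hk
        (le_fl_of_isFloat_le hfl (PTree.isFloat_two_zpow hp1 hk) (by linarith))

/-- Summands of admissible steps have a nonnegative sum. -/
theorem xsum_nonneg {emin : ℤ} : ∀ (ss : List LStep), (∀ s ∈ ss, s.OK emin) → 0 ≤ xsum ss
  | [], _ => le_rfl
  | s :: ss, hss => by
      obtain ⟨-, -, hx0, -⟩ := hss s (by simp)
      rw [xsum_cons]
      exact add_nonneg hx0 (xsum_nonneg ss (fun t ht => hss t (by simp [ht])))

/-- A ZERO RESULT MEANS A ZERO SUM: if the computed value is `0` then the start value and every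
summand vanish (a positive grid number is `≥ 2^emin`, a float of every format, and that lower bound
would propagate). -/
theorem lchainEval_eq_zero {emin : ℤ} :
    ∀ (ss : List LStep) (acc : ℚ), 0 ≤ acc → IsGrid emin acc → (∀ s ∈ ss, s.OK emin) →
      lchainEval acc ss = 0 → acc + xsum ss = 0
  | [], acc, _, _, _, h => by simpa using h
  | s :: ss, acc, hacc0, haccG, hss, h0 => by
      obtain ⟨hp1, hfl, hx0, hxG⟩ := hss s (by simp)
      have hrest : ∀ t ∈ ss, t.OK emin := fun t ht => hss t (by simp [ht])
      rw [lchainEval_cons] at h0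
      have hV0 : 0 ≤ acc + s.x := by linarith
      have ha'0 : 0 ≤ s.fl (acc + s.x) := le_fl_of_isFloat_le hfl (isFloat_zero _ _) hV0
      have ih := lchainEval_eq_zero ss _ ha'0 (isGrid_of_isFloat (hfl _).1) hrest h0
      have hxs0 : 0 ≤ xsum ss := xsum_nonneg ss hrest
      have ha'z : s.fl (acc + s.x) = 0 := by linarith
      have hV : acc + s.x = 0 := by
        by_contra hne
        have hpos : 0 < acc + s.x := lt_of_le_of_ne hV0 (Ne.symm hne)
        have h1 : (2 : ℚ) ^ emin ≤ acc + s.x := (haccG.add hxG).zpow_le_of_pos hpos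
        have h2 : (2 : ℚ) ^ emin ≤ s.fl (acc + s.x) :=
          le_fl_of_isFloat_le hfl (PTree.isFloat_two_zpow hp1 le_rfl) h1
        have h3 : (0 : ℚ) < (2 : ℚ) ^ emin := zpow_pos (by norm_num) _
        linarith
      rw [xsum_cons]; linarith

/-- CHAIN DEFICIT LEMMA (labelled): if the computed value `S_n` of an admissible chain is
`< 2^(K+1)` then `acc + Σ x_i - S_n ≤ (Σ_i u_{π_i}) · 2^K`.  Step `i` adds `x_i ≥ 0` to a value that
is eventually rounded to `S_n < 2^(K+1)`; were `S_{i-1} + x_i ≥ 2^(K+1)`, the float `2^(K+1)` would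
propagate to `S_n`.  So step `i` rounds inside a binade `≤ K` and loses at most `u_{π_i} 2^K` — and
nothing at all below its underflow threshold `2^(emin+π_i)` (grid numbers there are floats). -/
theorem lchain_deficit_le {emin : ℤ} :
    ∀ (ss : List LStep) (acc : ℚ), 0 ≤ acc → IsGrid emin acc → (∀ s ∈ ss, s.OK emin) →
      ∀ K : ℤ, lchainEval acc ss < (2 : ℚ) ^ (K + 1) →
        acc + xsum ss - lchainEval acc ss ≤ usum ss * (2 : ℚ) ^ K
  | [], acc, _, _, _, K, _ => by simp
  | s :: ss, acc, hacc0, haccG, hss, K, hK => by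
      obtain ⟨hp1, hfl, hx0, hxG⟩ := hss s (by simp)
      have hrest : ∀ t ∈ ss, t.OK emin := fun t ht => hss t (by simp [ht])
      simp only [lchainEval_cons] at hK ⊢
      set V := acc + s.x with hV
      set a' := s.fl V with ha'
      have hV0 : 0 ≤ V := by rw [hV]; linarith
      have ha'0 : 0 ≤ a' := le_fl_of_isFloat_le hfl (isFloat_zero _ _) hV0
      have hF : IsFloat s.prec emin a' := (hfl V).1
      have ih := lchain_deficit_le ss a' ha'0 (isGrid_of_isFloat hF) hrest K hK
      have hupos : 0 ≤ unitRoundoff s.prec * (2 : ℚ) ^ K :=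
        mul_nonneg (unitRoundoff_nonneg _) (zpow_nonneg (by norm_num) _)
      -- the step loses at most u_π 2^K
      have hstep : V - a' ≤ unitRoundoff s.prec * (2 : ℚ) ^ K := by
        by_cases hsm : V < (2 : ℚ) ^ (emin + s.prec)
        · have hex : a' = V := fl_eq_self hfl ((haccG.add hxG).isFloat_of_lt hV0 hsm)
          rw [hex, sub_self]; exact hupos
        · have hbig : (2 : ℚ) ^ (emin + s.prec) ≤ V := not_lt.mp hsm
          have hpos : 0 < V := lt_of_lt_of_le (zpow_pos (by norm_num) _) hbig
          set k := Int.log 2 V with hk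
          have hlow : ((2 : ℕ) : ℚ) ^ k ≤ V := Int.zpow_log_le_self (by norm_num) hpos
          have hup : V < ((2 : ℕ) : ℚ) ^ (k + 1) := Int.lt_zpow_succ_log_self (by norm_num) _
          push_cast at hlow hup
          have hk_ge : emin + s.prec ≤ k + 1 := by
            by_contra hlt
            have : (2 : ℚ) ^ (k + 1) ≤ (2 : ℚ) ^ (emin + (s.prec : ℤ)) :=
              zpow_le_zpow_right₀ (by norm_num) (by omega)
            linarith
          -- the float 2^(emin+π) ≤ V propagates to the final value, so emin + π < K + 1
          have hKe : emin ≤ K + 1 := by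
            have h3 : (2 : ℚ) ^ (emin + (s.prec : ℤ)) ≤ a' :=
              le_fl_of_isFloat_le hfl (PTree.isFloat_two_zpow hp1 (by omega)) hbig
            have h4 : (2 : ℚ) ^ (emin + (s.prec : ℤ)) ≤ lchainEval a' ss :=
              zpow_le_lchainEval ss a' hrest (by omega) h3
            by_contra hlt
            have h1 : (2 : ℚ) ^ (K + 1) ≤ (2 : ℚ) ^ (emin + (s.prec : ℤ)) :=
              zpow_le_zpow_right₀ (by norm_num) (by omega)
            linarith
          -- were V ≥ 2^(K+1), the float 2^(K+1) would propagate to the final value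
          have hlt2 : V < (2 : ℚ) ^ (K + 1) := by
            by_contra hc
            have h5 : (2 : ℚ) ^ (K + 1) ≤ a' :=
              le_fl_of_isFloat_le hfl (PTree.isFloat_two_zpow hp1 hKe) (not_lt.mp hc)
            have h6 := zpow_le_lchainEval ss a' hrest hKe h5
            linarith
          have hkK : k ≤ K := by
            by_contra hc
            have : (2 : ℚ) ^ (K + 1) ≤ (2 : ℚ) ^ k := zpow_le_zpow_right₀ (by norm_num) (by omega)
            linarith
          have herr := abs_sub_fl_le_half_ulp hp1 hfl hlow hup hk_ge
          have hmono : (2 : ℚ) ^ k ≤ (2 : ℚ) ^ K := zpow_le_zpow_right₀ (by norm_num) hkK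
          calc V - a' ≤ |V - a'| := le_abs_self _
            _ ≤ unitRoundoff s.prec * (2 : ℚ) ^ k := herr
            _ ≤ unitRoundoff s.prec * (2 : ℚ) ^ K :=
                mul_le_mul_of_nonneg_left hmono (unitRoundoff_nonneg _)
      rw [xsum_cons, usum_cons, add_mul]
      linarith

/-! ## The labelled chain law -/

/-- THE LABELLED CHAIN LAW, UPPER BOUND (Theorem T9(a)): for every sequence of step precisions
`π_i ≥ 1`, all nearest maps `fl_i` into `F(π_i, emin)`, every start value `acc ≥ 0` and summands
`x_i ≥ 0` on the grid `2^emin ℤ`:  `acc + Σ x_i ≤ (1 + Σ_i u_{π_i}) · S_n`. -/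
theorem exact_le_lchain {emin : ℤ} (ss : List LStep) (acc : ℚ) (hacc0 : 0 ≤ acc)
    (haccG : IsGrid emin acc) (hss : ∀ s ∈ ss, s.OK emin) :
    acc + xsum ss ≤ (1 + usum ss) * lchainEval acc ss := by
  set c := lchainEval acc ss with hc
  have hc0 : 0 ≤ c := lchainEval_nonneg ss acc hacc0 hss
  have hu0 : 0 ≤ usum ss := usum_nonneg ss
  rcases eq_or_lt_of_le hc0 with hzero | hpos
  · have h := lchainEval_eq_zero ss acc hacc0 haccG hss hzero.symm
    rw [h, ← hzero]; simp
  · set K := Int.log 2 c with hK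
    have hlow : ((2 : ℕ) : ℚ) ^ K ≤ c := Int.zpow_log_le_self (by norm_num) hpos
    have hupK : c < ((2 : ℕ) : ℚ) ^ (K + 1) := Int.lt_zpow_succ_log_self (by norm_num) _
    push_cast at hlow hupK
    have hdef : acc + xsum ss - c ≤ usum ss * (2 : ℚ) ^ K :=
      lchain_deficit_le ss acc hacc0 haccG hss K hupK
    have h1 : usum ss * (2 : ℚ) ^ K ≤ usum ss * c := mul_le_mul_of_nonneg_left hlow hu0
    have h2 : (1 + usum ss) * c = c + usum ss * c := by ring
    linarith

/-- Relative form: the under-estimation `acc + Σ x_i - S_n` is at most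
`(1 - 1/(1 + Σ u_{π_i})) · (acc + Σ x_i)`. -/
theorem lchain_relative {emin : ℤ} (ss : List LStep) (acc : ℚ) (hacc0 : 0 ≤ acc)
    (haccG : IsGrid emin acc) (hss : ∀ s ∈ ss, s.OK emin) :
    (acc + xsum ss) - lchainEval acc ss ≤ (1 - 1 / (1 + usum ss)) * (acc + xsum ss) := by
  have h := exact_le_lchain ss acc hacc0 haccG hss
  have hQ : 0 < 1 + usum ss := by have := usum_nonneg ss; linarith
  rw [sub_mul, one_mul, div_mul_eq_mul_div, one_mul, sub_le_sub_iff_left, div_le_iff₀ hQ]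
  linarith

/-! ## Sharpness: the bound is attained for every precision sequence -/

/-- `u_r 2^e = 2^(e-r)` is a (nonnegative) float of `F(r, emin)` once `e ≥ emin + r`. -/
theorem isFloat_zpow_mul_unitRoundoff {r : ℕ} (hr : 1 ≤ r) {emin e : ℤ} (he : emin + r ≤ e) :
    IsFloat r emin ((2 : ℚ) ^ e * unitRoundoff r) := by
  have h2 : (2 : ℚ) ≠ 0 := by norm_num
  refine ⟨1, e - r, ?_, by omega, ?_⟩
  · have h1 : (2 : ℤ) ≤ 2 ^ r := by
      calc (2 : ℤ) = 2 ^ 1 := by norm_num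
        _ ≤ 2 ^ r := pow_le_pow_right₀ (by norm_num) hr
    rw [abs_one]; linarith
  · unfold unitRoundoff
    rw [zpow_sub₀ h2, zpow_natCast]; push_cast
    ring

/-- THE STATIONARY WITNESS: from `S = 2^e`, adding `x_i = u_{π_i} 2^e` lands on the binade midpoint
`2^e (1 + u_{π_i})` of `F(π_i)`, which a ties-to-even map sends back to `2^e`: the running sum never
moves, and step `i` loses exactly `u_{π_i} 2^e`. -/
theorem lchainEval_witness_add {emin e : ℤ} (he : emin ≤ e) :
    ∀ (ss : List LStep),
      (∀ s ∈ ss, TiesEvenAtPow s.prec emin s.fl ∧ s.x = (2 : ℚ) ^ e * unitRoundoff s.prec) →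
      lchainEval ((2 : ℚ) ^ e) ss = (2 : ℚ) ^ e
  | [], _ => rfl
  | s :: ss, hss => by
      have hs := hss s (by simp)
      have hrest : ∀ t ∈ ss, TiesEvenAtPow t.prec emin t.fl ∧ t.x = (2 : ℚ) ^ e * unitRoundoff t.prec :=
        fun t ht => hss t (by simp [ht])
      rw [lchainEval_cons, hs.2, hs.1 e he]
      exact lchainEval_witness_add he ss hrest

/-- The witness summands add up to `(Σ u_{π_i}) 2^e`. -/
theorem xsum_witness_add {e : ℤ} :
    ∀ (ss : List LStep), (∀ s ∈ ss, s.x = (2 : ℚ) ^ e * unitRoundoff s.prec) →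
      xsum ss = (2 : ℚ) ^ e * usum ss
  | [], _ => by simp
  | s :: ss, hss => by
      rw [xsum_cons, usum_cons, hss s (by simp),
        xsum_witness_add ss (fun t ht => hss t (by simp [ht]))]
      ring

/-- THE LABELLED CHAIN LAW IS ATTAINED (Theorem T9(b)): with ties-to-even at the binade points,
the stationary witness gives equality `2^e + Σ x_i = (1 + Σ u_{π_i}) · S_n`, `S_n = 2^e`, for EVERY
sequence of step precisions. -/
theorem lchain_attained_add {emin e : ℤ} (he : emin ≤ e) (ss : List LStep)
    (hss : ∀ s ∈ ss, TiesEvenAtPow s.prec emin s.fl ∧ s.x = (2 : ℚ) ^ e * unitRoundoff s.prec) :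
    lchainEval ((2 : ℚ) ^ e) ss = (2 : ℚ) ^ e ∧
      (2 : ℚ) ^ e + xsum ss = (1 + usum ss) * lchainEval ((2 : ℚ) ^ e) ss := by
  have hc := lchainEval_witness_add he ss hss
  refine ⟨hc, ?_⟩
  rw [hc, xsum_witness_add ss (fun s hs => (hss s hs).2)]
  ring

end Summit.Ventures.CertifiedArithmetic.LowPrec.Opt
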